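import Literature.NumberTheory.GaloisRepresentations.EisensteinSexticRamificationEngine
import Mathlib.NumberTheory.LSeries.PrimesInAP
import Literature.NumberTheory.NumberFields.CongruenceSubgroupTorsionFree
import HarnessLib

/-!
# The Größencharakter of `y² = x³ + k` is ramified above the primes of `2k` away from `3`, II: the quadratic witness at an odd `p` with
# `ord_p k = 3` (Ireland–Rosen Ch. 18 §7; Jacobi reciprocity, Ch. 5 §2)

Topic `Literature/NumberTheory/GaloisRepresentations`, namespace `Literature.NumberTheory.GaloisRepresentations.EisensteinSextic` (sequel of
`EisensteinSexticRamificationEngine`; cell `bsd-wall`, seat bed-w3 g17).  THEOREMS only, unconditional.  When `ord_p(4k) = 3` the cubic part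
`(4k/·)₃` of `ψ` is unramified at `p`, and the ramification comes from the quadratic part `(k/N·)`: with the auxiliary prime `𝔮 = (ϖ)`,
`ϖ ≡ g₀ (mod 36k)`, one has `(k/N𝔮) = (k/N(g₀))` (§9 `jacobiSym_absNorm_eq_of_sub_mem`: congruent elements have congruent norms) and
`(k/N(g₀)) = (N(g₀)/p)` (`jacobiSym_eq_legendreSym_of_eq_pow_three_mul`, Jacobi reciprocity with `N(g₀) ≡ 1 (mod 4|k/p³|)`), so it suffices to seed
`g` with `(N(g₀)/p) = −1`: at a split `𝔭_w` a rational non-residue `t` (`exists_seed_of_residueCard_eq`: `N(g₀) = g₀·cg₀ ≡ t`), at an inert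
`(p)` the primary prime over an auxiliary rational prime `ℓ ≡ 1 (mod 3)` which is a non-residue mod `p` (`exists_seed_of_mod_three_eq_two`,
Dirichlet + `N(g₀) ≡ N(g) = ℓ (mod p)`).

* §9 `intCast_mem_iff_dvd`, `odd_absNorm_of_isCoprime_modulus`, `span_natAbs_eq`, ★ `jacobiSym_absNorm_eq_of_sub_mem`,
  `jacobiSym_eq_legendreSym_of_eq_pow_three_mul`, `smul_sub_one_mem_of_residueCard_eq`, `exists_seed_of_residueCard_eq`,
  `exists_seed_of_mod_three_eq_two`, `absNorm_modEq_one_of_sub_one_mem`, ★★ `not_isUnramifiedAt_psi_of_ord_eq_three` — **`ψ` is ramified at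
  `𝔭_w ∣ p` for every odd `p ≠ 3` with `ord_p k = 3`.**

Nothing about BSD is proved here; no modularity is used.

## References
* K. Ireland, M. Rosen, *A Classical Introduction to Modern Number Theory*, 2nd ed., GTM 84 (1990), Ch. 5 §2 (Jacobi symbol, reciprocity),
  Ch. 9 §1 (`ℤ[ω]`), §3 Theorem 1 (cubic reciprocity) with §4 (proof), Ch. 18 §3 Theorem 4, §6 Theorem 7 (proof: «`χ` is a Hecke character
  … with conductor dividing `12D`»), §7 («if `P ∣ 6D` define `χ(P) = 0`», Theorem 4′). [IrelandRosen1990]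
* J. Neukirch, *Algebraic Number Theory* (1999), Ch. I §3, Ch. VI §1 (1.7)–(1.9), Ch. VII §6 (6.13)–(6.14), §13 (13.2). [NeukirchANT1999]
* E. Landau, *Über Ideale und Primideale in Idealklassen*, Math. Z. 2 (1918), §1. [Landau1918Idealklassen]
* J. H. Silverman, *Advanced Topics in the Arithmetic of Elliptic Curves* (1994), II Thm. 9.2, Thm. 10.5. [SilvermanATAEC1994]

## Mathlib / tree search
Tree: `EisensteinSexticRamificationEngine` (§§7–8), `absNorm_span_modEq`, `not_dvd_absNorm_of_isCoprime`, `varpi`, `span_varpi`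
(`EisensteinSexticPrimes`), `RingOfIntegers.exists_heightOneSpectrum_natCast_mem` (`NumberFields/CongruenceSubgroupTorsionFree`, found by the dedup lint).  Mathlib: `jacobiSym.mod_right`, `jacobiSym.mul_left`, `jacobiSym.pow_left`, `jacobiSym.quadratic_reciprocity_one_mod_four`,
`jacobiSym.legendreSym.to_jacobiSym`, `jacobiSym.trichotomy`, `legendreSym.eq_neg_one_iff`, `legendreSym.mod`, `FiniteField.exists_nonsquare`,
`Nat.chineseRemainder`, `Nat.forall_exists_prime_gt_and_eq_mod` (Dirichlet), `ZMod.isUnit_iff_coprime`, `ZMod.natCast_eq_natCast_iff`,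
`Nat.ModEq.of_mul_right/of_mul_left/of_dvd`.
-/

noncomputable section

open NumberField IsDedekindDomain IsDedekindDomain.HeightOneSpectrum
open scoped NumberTheorySymbols ComplexConjugate Pointwise

namespace Literature.NumberTheory.GaloisRepresentations.EisensteinSextic

open Literature.NumberTheory.GaloisRepresentations
open Literature.NumberTheory.LFunctions (idealPow isCoprime_span_of_sub_mem RayClassRel CoprimeIdeal
  exists_rayClassRel_prime_absNorm_not_mem)
open Literature.NumberTheory.LFunctions.AbelianDensity (artinSymbol artinSymbol_asIdeal)
open Literature.NumberTheory.Automorphic (RingOfIntegers.coe_algEquiv_smul HeightOneSpectrum.smul_mem_smul_asIdeal_iff)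

variable {K : Type} [Field K] [NumberField K]

section Quadratic

variable {ζ : 𝓞 K} (hζ : IsPrimitiveRoot ζ 3) [IsCyclotomicExtension {3} ℚ K]

/-! ### §9 The quadratic part `(k/N𝔮)` when the cubic part is trivial (`3 ∣ ord_p(4k)`): the witnesses with `(k/N𝔮) = −1` -/

omit [IsCyclotomicExtension {3} ℚ K] in
/-- Rational integers in a prime `𝔭_w ∋ p`: `a ∈ 𝔭_w ↔ p ∣ a` (`(p, a) = 1 ⇒ 1 ∈ 𝔭_w`). [cite: NeukirchANT1999, Ch. I §3 Thm. (3.6)] -/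
theorem intCast_mem_iff_dvd {p : ℕ} (hp : p.Prime) {w : HeightOneSpectrum (𝓞 K)} (hpw : (p : 𝓞 K) ∈ w.asIdeal) (a : ℤ) :
    (a : 𝓞 K) ∈ w.asIdeal ↔ (p : ℤ) ∣ a := by
  constructor
  · intro ha
    by_contra hnd
    obtain ⟨u, v, huv⟩ := (Nat.prime_iff_prime_int.mp hp).irreducible.coprime_iff_not_dvd.mpr hnd
    apply w.isPrime.ne_top
    rw [Ideal.eq_top_iff_one]
    have : (1 : 𝓞 K) = (u : 𝓞 K) * (p : 𝓞 K) + (v : 𝓞 K) * (a : 𝓞 K) := by exact_mod_cast congrArg (Int.cast (R := 𝓞 K)) huv.symm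
    rw [this]
    exact w.asIdeal.add_mem (w.asIdeal.mul_mem_left _ hpw) (w.asIdeal.mul_mem_left _ ha)
  · rintro ⟨b, rfl⟩
    push_cast
    exact w.asIdeal.mul_mem_right _ hpw

omit [NumberField K] [IsCyclotomicExtension {3} ℚ K] in
/-- `(|z|) = (z)` as ideals. [cite: NeukirchANT1999, Ch. I §3 (principal ideals and associated elements)] -/
theorem span_natAbs_eq (z : ℤ) : Ideal.span {((z.natAbs : ℕ) : 𝓞 K)} = Ideal.span {(z : 𝓞 K)} := by
  rw [Nat.cast_natAbs]
  rcases abs_choice z with h1 | h1 <;> rw [h1]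
  rw [Int.cast_neg, Ideal.span_singleton_neg]

omit [IsCyclotomicExtension {3} ℚ K] in
/-- The norm of a nonzero integer prime to `36k` is odd. [cite: IrelandRosen1990, Ch. 18 §7] -/
theorem odd_absNorm_of_isCoprime_modulus {k : ℤ} {x : 𝓞 K} (hx0 : x ≠ 0) (hx : IsCoprime (Ideal.span {x}) (modulus k)) :
    Odd (Ideal.absNorm (Ideal.span {x})) := by
  have h2 : IsCoprime (Ideal.span {x}) (Ideal.span {((2 : ℕ) : 𝓞 K)}) := by
    rw [Ideal.isCoprime_iff_sup_eq] at hx ⊢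
    refine top_le_iff.mp (hx ▸ sup_le_sup_left ?_ _)
    rw [modulus]
    exact Ideal.span_singleton_le_span_singleton.mpr ⟨((18 * k : ℤ) : 𝓞 K), by push_cast; ring⟩
  have hx0' : (Ideal.span {x} : Ideal (𝓞 K)) ≠ ⊥ := by rwa [Ne, Ideal.span_singleton_eq_bot]
  exact Nat.odd_iff.mpr (Nat.two_dvd_ne_zero.mp (not_dvd_absNorm_of_isCoprime hx0' Nat.prime_two h2))

/-- ★ **The quadratic factor only sees the class modulo `36k`**: for `ϖ ≡ g₀ (mod 36k)`, both nonzero and prime to `36k`,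
`(k / N((ϖ))) = (k / N((g₀)))` (congruent elements have congruent norms, `absNorm_span_modEq`, and `jacobiSym.mod_right` — the period of
`(k/·)` divides `4|k| ∣ 36|k|`). [cite: IrelandRosen1990, Ch. 18 §6, proof of Theorem 7] -/
theorem jacobiSym_absNorm_eq_of_sub_mem {k : ℤ} {ϖ g₀ : 𝓞 K} (hϖ0 : ϖ ≠ 0) (hg₀0 : g₀ ≠ 0) (h : ϖ - g₀ ∈ modulus k)
    (hϖ : IsCoprime (Ideal.span {ϖ}) (modulus k)) (hg₀ : IsCoprime (Ideal.span {g₀}) (modulus k)) :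
    J(k | Ideal.absNorm (Ideal.span {ϖ})) = J(k | Ideal.absNorm (Ideal.span {g₀})) := by
  have hmod : Ideal.absNorm (Ideal.span {ϖ}) ≡ Ideal.absNorm (Ideal.span {g₀}) [MOD (36 * k).natAbs] := by
    apply absNorm_span_modEq
    have : Ideal.span {(((36 * k).natAbs : ℕ) : 𝓞 K)} = modulus k := by rw [span_natAbs_eq, modulus]
    rwa [this]
  rw [jacobiSym.mod_right k (odd_absNorm_of_isCoprime_modulus hϖ0 hϖ),
    jacobiSym.mod_right k (odd_absNorm_of_isCoprime_modulus hg₀0 hg₀), hmod.of_dvd ⟨9, ?_⟩]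
  rw [Int.natAbs_mul]; norm_num; ring

omit [NumberField K] [IsCyclotomicExtension {3} ℚ K] in
/-- **`(k/n) = (n/p)` when `k = p³m′`, `n ≡ 1 (mod 4|m′|)`, `n ≡ 1 (mod 4)`** (`p` odd): `(m′/n) = (m′/1) = 1`, `(p/n)³ = (p/n) = (n/p)` by
quadratic reciprocity. [cite: IrelandRosen1990, Ch. 5 §2 Prop. 5.2.2 and Theorem 2 (Jacobi reciprocity)] -/
theorem jacobiSym_eq_legendreSym_of_eq_pow_three_mul {p : ℕ} [Fact p.Prime] (hp2 : p ≠ 2) {k m' : ℤ}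
    (hk : k = (p : ℤ) ^ 3 * m') {n : ℕ} (hn : Odd n) (hn1 : n ≡ 1 [MOD 4 * m'.natAbs]) (hn4 : n % 4 = 1) :
    J(k | n) = legendreSym p n := by
  have hp := (Fact.out : p.Prime)
  have hm' : J(m' | n) = 1 := by
    rw [jacobiSym.mod_right m' hn, hn1, ← jacobiSym.mod_right m' odd_one, jacobiSym.one_right]
  have hcube : J((p : ℤ) | n) ^ 3 = J((p : ℤ) | n) := by
    rcases jacobiSym.trichotomy (p : ℤ) n with h | h | h <;> rw [h] <;> norm_num
  rw [hk, jacobiSym.mul_left, jacobiSym.pow_left, hm', mul_one, hcube,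
    ← jacobiSym.quadratic_reciprocity_one_mod_four hn4 (hp.odd_of_ne_two hp2), ← jacobiSym.legendreSym.to_jacobiSym]

include hζ in
/-- `c • x ≡ 1 (mod 𝔭_w)` for a split `𝔭_w ∣ 36k` over `p ≠ 3` and `x ≡ 1` modulo the prime powers of `(36k)` away from `𝔭_w`
(`c𝔭_w ≠ 𝔭_w` is one of them). [cite: IrelandRosen1990, Ch. 9 §1 Prop. 9.1.4] -/
theorem smul_sub_one_mem_of_residueCard_eq {k : ℤ} (hk : k ≠ 0) {w : HeightOneSpectrum (𝓞 K)} (hw : modulus k ≤ w.asIdeal)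
    {p : ℕ} (hp : p.Prime) (hp3 : p ≠ 3) (hpw : (p : 𝓞 K) ∈ w.asIdeal) (hwp : w.residueCard = p)
    {x : 𝓞 K} (hcong : ∀ v : HeightOneSpectrum (𝓞 K), v ≠ w → modulusExp (modulus k) v ≠ 0 →
      x - 1 ∈ v.asIdeal ^ modulusExp (modulus k) v) {c : K ≃ₐ[ℚ] K} (hc : c ≠ 1) :
    c • x - 1 ∈ w.asIdeal := by
  have h𝔣 : modulus (K := K) k ≠ ⊥ := modulus_ne_bot hk
  have hp31 : p % 3 = 1 := by
    have h0 : p % 3 ≠ 0 := fun h => hp3 ((Nat.prime_dvd_prime_iff_eq Nat.prime_three hp).mp (Nat.dvd_of_mod_eq_zero h)).symm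
    by_contra h1
    have h2 : p % 3 = 2 := by omega
    have hN : w.residueCard = p ^ 2 := by
      rw [show w.residueCard = Ideal.absNorm w.asIdeal from rfl, asIdeal_eq_span_of_mod_three_eq_two hp h2 hpw,
        show ((p : ℕ) : 𝓞 K) = ((p : ℤ) : 𝓞 K) by push_cast; rfl, absNorm_span_intCast, Int.natAbs_natCast]
    rw [hwp] at hN
    exact absurd hN (by nlinarith [hp.two_le])
  have hcw : c • w ≠ w := smul_ne_self_of_mod_three_eq_one hζ hc hp hp31 hpw
  have hcw𝔣 : modulus k ≤ (c • w).asIdeal := by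
    rw [modulus_le_iff] at hw ⊢
    exact (intCast_mem_smul_iff c w _).mpr hw
  have he : modulusExp (modulus k) (c • w) ≠ 0 := (modulusExp_ne_zero_iff _ h𝔣 _).mpr hcw𝔣
  have h1 : x - 1 ∈ (c • w).asIdeal := Ideal.pow_le_self he (hcong (c • w) hcw he)
  have h := (HeightOneSpectrum.smul_mem_smul_asIdeal_iff c (c • w) (x - 1)).mpr h1
  rw [smul_smul, algEquiv_mul_self hc, one_smul, smul_sub, smul_one] at h
  exact h


include hζ in
/-- **Seed for the quadratic witness at a split `𝔭_w ∣ p`** (`p ≡ 1 (mod 3)`, odd): a rational non-residue `t (mod p)`; for every `g₀ ≡ t (mod 𝔭_w)`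
with `cg₀ ≡ 1 (mod 𝔭_w)` one has `N((g₀)) = g₀·cg₀ ≡ t (mod p)`, so `(N(g₀)/p) = −1`. [cite: IrelandRosen1990, Ch. 5 §1, Ch. 9 §1 Prop. 9.1.4] -/
theorem exists_seed_of_residueCard_eq {k : ℤ} (hk : k ≠ 0) {w : HeightOneSpectrum (𝓞 K)} (hw : modulus k ≤ w.asIdeal)
    {p : ℕ} [Fact p.Prime] (hp2 : p ≠ 2) (hp3 : p ≠ 3) (hpw : (p : 𝓞 K) ∈ w.asIdeal) (hwp : w.residueCard = p) :
    ∃ g : 𝓞 K, g ∉ w.asIdeal ∧ ∀ g₀ : 𝓞 K, g₀ - g ∈ w.asIdeal →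
      (∀ v : HeightOneSpectrum (𝓞 K), v ≠ w → modulusExp (modulus k) v ≠ 0 → g₀ - 1 ∈ v.asIdeal ^ modulusExp (modulus k) v) →
      legendreSym p (Ideal.absNorm (Ideal.span {g₀})) = -1 := by
  have hp := (Fact.out : p.Prime)
  obtain ⟨a, ha⟩ := FiniteField.exists_nonsquare (F := ZMod p) (by rw [ZMod.ringChar_zmod_n]; exact hp2)
  set t : ℤ := (a.val : ℤ) with ht
  have hta : (t : ZMod p) = a := by rw [ht, Int.cast_natCast, ZMod.natCast_zmod_val]
  have hleg : legendreSym p t = -1 := (legendreSym.eq_neg_one_iff p).mpr (by rwa [hta])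
  have hpt : ¬ (p : ℤ) ∣ t := fun h => by
    have h0 : (t : ZMod p) = 0 := (ZMod.intCast_zmod_eq_zero_iff_dvd t p).mpr h
    rw [hta] at h0
    exact ha (h0 ▸ IsSquare.zero)
  refine ⟨(t : 𝓞 K), fun h => hpt ((intCast_mem_iff_dvd hp hpw t).mp h), fun g₀ hg₀g hcong => ?_⟩
  obtain ⟨c, hc⟩ := exists_algEquiv_ne_one (K := K)
  have hcg₀ : c • g₀ - 1 ∈ w.asIdeal := smul_sub_one_mem_of_residueCard_eq hζ hk hw hp hp3 hpw hwp hcong hc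
  set n₀ := Ideal.absNorm (Ideal.span {g₀}) with hn₀def
  have hn₀ : ((n₀ : ℕ) : 𝓞 K) = g₀ * c • g₀ := natCast_absNorm_span_eq_mul_smul hc g₀
  have hmem : (((n₀ : ℤ) - t : ℤ) : 𝓞 K) ∈ w.asIdeal := by
    have : (((n₀ : ℤ) - t : ℤ) : 𝓞 K) = g₀ * (c • g₀ - 1) + (g₀ - (t : 𝓞 K)) := by push_cast; rw [hn₀]; ring
    rw [this]; exact w.asIdeal.add_mem (w.asIdeal.mul_mem_left _ hcg₀) hg₀g
  have hdvd : (p : ℤ) ∣ (n₀ : ℤ) - t := (intCast_mem_iff_dvd hp hpw _).mp hmem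
  have hmodeq : (n₀ : ℤ) ≡ t [ZMOD p] := Int.modEq_iff_dvd.mpr (dvd_sub_comm.mp hdvd)
  rw [legendreSym.mod p n₀, (hmodeq : (n₀ : ℤ) % p = t % p), ← legendreSym.mod, hleg]

include hζ in
/-- **Seed for the quadratic witness at an inert `𝔭_w = (p)`** (`p ≡ 2 (mod 3)` odd): a primary prime `g = ϖ_v` of `K` lying over an
auxiliary rational prime `ℓ ≡ 1 (mod 3)` which is a non-residue `mod p` (Dirichlet); `N((g)) = ℓ`, and `N((g₀)) ≡ ℓ (mod p)` for every
`g₀ ≡ g (mod p)`. [cite: IrelandRosen1990, Ch. 9 §1 Prop. 9.1.4; Ch. 16 §1 (Dirichlet)] -/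
theorem exists_seed_of_mod_three_eq_two {w : HeightOneSpectrum (𝓞 K)} {p : ℕ} [Fact p.Prime] (hp2 : p ≠ 2) (hp32 : p % 3 = 2)
    (hpw : (p : 𝓞 K) ∈ w.asIdeal) :
    ∃ g : 𝓞 K, g ∉ w.asIdeal ∧ ∀ g₀ : 𝓞 K, g₀ - g ∈ w.asIdeal → legendreSym p (Ideal.absNorm (Ideal.span {g₀})) = -1 := by
  have hp := (Fact.out : p.Prime)
  have hp3 : p ≠ 3 := by rintro rfl; norm_num at hp32
  obtain ⟨a, ha⟩ := FiniteField.exists_nonsquare (F := ZMod p) (by rw [ZMod.ringChar_zmod_n]; exact hp2)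
  have ha0 : a ≠ 0 := fun h => ha (h ▸ IsSquare.zero)
  have hpa : ¬ p ∣ a.val := fun h => ha0 (by
    rw [← ZMod.natCast_zmod_val a, ZMod.natCast_eq_zero_iff]; exact h)
  -- CRT: `r₀ ≡ 1 (3)`, `r₀ ≡ a (p)`; Dirichlet: a prime `ℓ ≡ r₀ (3p)`
  have h3p : Nat.Coprime 3 p := (Nat.coprime_primes Nat.prime_three hp).mpr (Ne.symm hp3)
  set r₀ : ℕ := (Nat.chineseRemainder h3p 1 a.val : ℕ) with hr₀
  have hr₃ : r₀ ≡ 1 [MOD 3] := (Nat.chineseRemainder h3p 1 a.val).2.1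
  have hrₚ : r₀ ≡ a.val [MOD p] := (Nat.chineseRemainder h3p 1 a.val).2.2
  have hrcop : Nat.Coprime r₀ (3 * p) := by
    refine Nat.Coprime.mul_right ?_ ?_
    · rw [Nat.coprime_comm, Nat.Prime.coprime_iff_not_dvd Nat.prime_three]
      intro h
      have h1 : r₀ % 3 = 1 % 3 := hr₃
      omega
    · rw [Nat.coprime_comm, Nat.Prime.coprime_iff_not_dvd hp]
      intro h
      apply hpa
      rw [Nat.dvd_iff_mod_eq_zero] at h ⊢
      have h1 : r₀ % p = a.val % p := hrₚ
      rw [← h1, h]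
  have hunit : IsUnit (r₀ : ZMod (3 * p)) := (ZMod.isUnit_iff_coprime r₀ (3 * p)).mpr hrcop
  haveI : NeZero (3 * p) := ⟨mul_ne_zero (by norm_num) hp.ne_zero⟩
  obtain ⟨ℓ, -, hℓ, hℓr⟩ := Nat.forall_exists_prime_gt_and_eq_mod hunit 0
  have hℓmod : ℓ ≡ r₀ [MOD 3 * p] := (ZMod.natCast_eq_natCast_iff _ _ _).mp hℓr
  have hℓ3 : ℓ % 3 = 1 := by
    have h : ℓ ≡ 1 [MOD 3] := (hℓmod.of_mul_right p).trans hr₃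
    exact h
  have hℓp : ℓ ≡ a.val [MOD p] := (hℓmod.of_mul_left 3).trans hrₚ
  have hℓ3' : Nat.Coprime ℓ 3 := by
    rw [Nat.coprime_comm, Nat.Prime.coprime_iff_not_dvd Nat.prime_three]; omega
  -- a (degree-one) prime `v` of `K` above `ℓ` and its primary generator `g`
  obtain ⟨v, hℓv⟩ := Literature.NumberTheory.NumberFields.RingOfIntegers.exists_heightOneSpectrum_natCast_mem K hℓ
  have hNv : v.residueCard = ℓ := residueCard_eq_of_mod_three_eq_one hℓ hℓ3 hℓv
  have h3v : (3 : 𝓞 K) ∉ v.asIdeal := three_not_mem_of_natCast_mem hℓv hℓ3'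
  have hgspan : Ideal.span {varpi hζ v} = v.asIdeal := span_varpi hζ h3v
  have hNg : Ideal.absNorm (Ideal.span {varpi hζ v}) = ℓ := by rw [hgspan]; exact hNv
  have hw_eq : w.asIdeal = Ideal.span {(p : 𝓞 K)} := asIdeal_eq_span_of_mod_three_eq_two hp hp32 hpw
  have hNw : w.residueCard = p ^ 2 := by
    rw [show w.residueCard = Ideal.absNorm w.asIdeal from rfl, hw_eq,
      show ((p : ℕ) : 𝓞 K) = ((p : ℤ) : 𝓞 K) by push_cast; rfl, absNorm_span_intCast, Int.natAbs_natCast]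
  refine ⟨varpi hζ v, fun hg => ?_, fun g₀ hg₀g => ?_⟩
  · have hle : v.asIdeal ≤ w.asIdeal := by rw [← hgspan]; exact (Ideal.span_singleton_le_iff_mem _).mpr hg
    have heq : v = w := HeightOneSpectrum.ext (v.isMaximal.eq_of_le w.isPrime.ne_top hle)
    rw [heq, hNw] at hNv
    -- `p² = ℓ` is prime: impossible
    rcases hℓ.eq_one_or_self_of_dvd p (by rw [← hNv]; exact dvd_pow_self p two_ne_zero) with h1 | h1
    · exact hp.one_lt.ne' h1
    · rw [← h1, show p = p ^ 1 from (pow_one p).symm, ← pow_mul, one_mul] at hNv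
      exact absurd (Nat.pow_right_injective hp.two_le hNv) (by norm_num)
  · have hmod : Ideal.absNorm (Ideal.span {g₀}) ≡ ℓ [MOD p] := by
      rw [← hNg]
      apply absNorm_span_modEq
      rw [← hw_eq]; exact hg₀g
    have hcast : ((Ideal.absNorm (Ideal.span {g₀}) : ℕ) : ZMod p) = a := by
      rw [(ZMod.natCast_eq_natCast_iff _ _ _).mpr (hmod.trans hℓp), ZMod.natCast_zmod_val]
    exact (legendreSym.eq_neg_one_iff p).mpr (by rw [Int.cast_natCast, hcast]; exact ha)


/-- `N((g₀)) ≡ 1 (mod |z|)` when `g₀ ≡ 1 (mod z)`. [cite: IrelandRosen1990, Ch. 18 §6, proof of Theorem 7] -/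
theorem absNorm_modEq_one_of_sub_one_mem {g₀ : 𝓞 K} {z : ℤ} (h : g₀ - 1 ∈ Ideal.span {(z : 𝓞 K)}) :
    Ideal.absNorm (Ideal.span {g₀}) ≡ 1 [MOD z.natAbs] := by
  have h' := absNorm_span_modEq (K := K) (b := g₀) (c := 1) (m := z.natAbs) (by rwa [span_natAbs_eq])
  rwa [Ideal.span_singleton_one, Ideal.absNorm_top] at h'

include hζ in
/-- ★★ **Ramification above an odd `p` with `ord_p k = 3`** (cubic part unramified at `p`, quadratic part `(k/·) = (p³m′/·)` ramified):
seed `g` with `(N(g₀)/p) = −1` (split: a rational non-residue; inert: a prime over an auxiliary `ℓ`), auxiliary prime `𝔮 = (ϖ)`; then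
`ψ̃((ϖ))/e(ϖ) = (k/N𝔮)·χ_w(g)³ = (k/N(g₀)) = (N(g₀)/p) = −1`. [cite: IrelandRosen1990, Ch. 18 §7; Ch. 5 §2 Theorem 2] [cite: SilvermanATAEC1994, II Thm. 10.5] -/
theorem not_isUnramifiedAt_psi_of_ord_eq_three {k : ℤ} (hk : k ≠ 0) (w₀ : InfinitePlace K) {p : ℕ} [Fact p.Prime]
    (hp2 : p ≠ 2) (hp3 : p ≠ 3) {m' : ℤ} (hkm : k = (p : ℤ) ^ 3 * m') (hpm : ¬ (p : ℤ) ∣ m')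
    {w : HeightOneSpectrum (𝓞 K)} (hpw : (p : 𝓞 K) ∈ w.asIdeal) (hw : modulus k ≤ w.asIdeal) :
    ¬ (heckeOfGross (modulus_ne_bot hk) (isGrossencharakter_psi_one_zero hζ hk w₀)).IsUnramifiedAt w := by
  have hp := (Fact.out : p.Prime)
  have hpZ : Prime (p : ℤ) := Nat.prime_iff_prime_int.mp hp
  have hp3' : Nat.Coprime p 3 := (Nat.coprime_primes hp Nat.prime_three).mpr hp3
  have h3w : (3 : 𝓞 K) ∉ w.asIdeal := three_not_mem_of_natCast_mem hpw hp3'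
  have h𝔣 : modulus (K := K) k ≠ ⊥ := modulus_ne_bot hk
  have he : modulusExp (modulus k) w ≠ 0 := (modulusExp_ne_zero_iff _ h𝔣 w).mpr hw
  have hkm4 : 4 * k = (p : ℤ) ^ 3 * (4 * m') := by rw [hkm]; ring
  have hpm4 : ¬ (p : ℤ) ∣ 4 * m' := fun h => by
    rcases hpZ.dvd_or_dvd h with h4 | h4
    · have h2 : (p : ℤ) ∣ 2 := hpZ.dvd_of_dvd_pow (n := 2) (by norm_num; exact h4)
      exact hp2 ((Nat.prime_dvd_prime_iff_eq hp Nat.prime_two).mp (by exact_mod_cast h2))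
    · exact hpm h4
  -- the seed
  obtain ⟨g, hg, hleg⟩ : ∃ g : 𝓞 K, g ∉ w.asIdeal ∧ ∀ g₀ : 𝓞 K, g₀ - g ∈ w.asIdeal →
      (∀ v : HeightOneSpectrum (𝓞 K), v ≠ w → modulusExp (modulus k) v ≠ 0 → g₀ - 1 ∈ v.asIdeal ^ modulusExp (modulus k) v) →
      legendreSym p (Ideal.absNorm (Ideal.span {g₀})) = -1 := by
    by_cases h1 : p % 3 = 1
    · exact exists_seed_of_residueCard_eq hζ hk hw hp2 hp3 hpw (residueCard_eq_of_mod_three_eq_one hp h1 hpw)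
    · have h2 : p % 3 = 2 := by
        have h0 : p % 3 ≠ 0 := fun h => hp3 ((Nat.prime_dvd_prime_iff_eq Nat.prime_three hp).mp (Nat.dvd_of_mod_eq_zero h)).symm
        omega
      obtain ⟨g, hg, h⟩ := exists_seed_of_mod_three_eq_two hζ hp2 h2 hpw
      exact ⟨g, hg, fun g₀ hg₀ _ => h g₀ hg₀⟩
  obtain ⟨J, g₀, ϖ, 𝔮, h𝔣J, hg₀1, hg₀g, hg₀cop, hϖ, hϖg₀, -, hϖcop, hϖg, hϖw, hcong, hg₀cong⟩ := exists_auxPrime hk hw g hg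
  obtain ⟨hg₀9, hϖ9, hϖ3, hp𝔮⟩ := auxPrime_sub_one_mem hp hp3 hkm4 hpm4 three_ne_zero hpw h𝔣J hg₀1 hϖg₀ hϖ hϖcop
  have hN := fun hwp : w.residueCard = p => residueCard_mul_sub_sq_mem hζ hk hw hp hp3 hpw hwp hϖ hϖg hcong
  have hcubic := cubicResidueSymbol_intCast_eq_pow hζ hp3 hkm4 hϖ hϖ9 hp𝔮 hpw hg hϖg hN
  have hg0 : Ideal.Quotient.mk w.asIdeal g ≠ 0 := fun h0 => hg (Ideal.Quotient.eq_zero_iff_mem.mp h0)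
  rw [(cubicResidueSymbol_spec hζ h3w hg0).1] at hcubic
  have hϖ0 : ϖ ≠ 0 := fun h => 𝔮.ne_bot (by rw [← hϖ, h, Ideal.span_singleton_eq_bot])
  have hg₀0 : g₀ ≠ 0 := by
    rintro rfl
    exact hg (by have := hg₀g; rw [zero_sub] at this; exact (w.asIdeal.neg_mem_iff).mp (Ideal.pow_le_self he this))
  refine not_isUnramifiedAt_psi_of_prime hζ hk w₀ hw hϖ hϖw hϖcop hϖ3 hcong ?_
  rw [hcubic, show ((1 : 𝓞 K) : K) = 1 by norm_cast, map_one, mul_one, ← hϖ,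
    jacobiSym_absNorm_eq_of_sub_mem hϖ0 hg₀0 hϖg₀ hϖcop hg₀cop]
  -- the quadratic factor `(k / N(g₀)) = (N(g₀)/p) = −1`
  have hn36 : Ideal.absNorm (Ideal.span {g₀}) ≡ 1 [MOD (9 * (4 * m')).natAbs] := absNorm_modEq_one_of_sub_one_mem hg₀9
  have hn4m : Ideal.absNorm (Ideal.span {g₀}) ≡ 1 [MOD 4 * m'.natAbs] :=
    hn36.of_dvd ⟨9, by rw [Int.natAbs_mul, Int.natAbs_mul]; norm_num; ring⟩
  have hn4 : Ideal.absNorm (Ideal.span {g₀}) % 4 = 1 := by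
    have h : Ideal.absNorm (Ideal.span {g₀}) ≡ 1 [MOD 4] := hn4m.of_dvd ⟨m'.natAbs, rfl⟩
    exact h
  rw [jacobiSym_eq_legendreSym_of_eq_pow_three_mul hp2 hkm (odd_absNorm_of_isCoprime_modulus hg₀0 hg₀cop) hn4m hn4,
    hleg g₀ (Ideal.pow_le_self he hg₀g) hg₀cong]
  norm_num

omit [IsCyclotomicExtension {3} ℚ K] in
/-- Rational primes in a prime `𝔭_w ∋ p`: `q ∈ 𝔭_w ↔ q = p` for a prime `q` (the `ℕ`-form of `intCast_mem_iff_dvd`).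
[cite: NeukirchANT1999, Ch. I §3 Thm. (3.6)] -/
theorem natCast_prime_mem_iff_eq {p q : ℕ} (hp : p.Prime) (hq : q.Prime) {w : HeightOneSpectrum (𝓞 K)}
    (hpw : (p : 𝓞 K) ∈ w.asIdeal) : (q : 𝓞 K) ∈ w.asIdeal ↔ q = p := by
  have h := intCast_mem_iff_dvd hp hpw (q : ℤ)
  rw [Int.cast_natCast, Int.natCast_dvd_natCast] at h
  rw [h, Nat.prime_dvd_prime_iff_eq hp hq, eq_comm]

end Quadratic

end Literature.NumberTheory.GaloisRepresentations.EisensteinSextic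

end
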